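import Literature.AlgebraicGeometry.Resolution.SubfieldTransport
import Literature.AlgebraicGeometry.Resolution.ValuedFunctionFieldsLemmas
import Literature.AlgebraicGeometry.Resolution.LocalUniformizationAbhyankarPlacesProofs
import HarnessLib

/-!
# Transport of the Abhyankar property along a field embedding (`stub_isAbhyankarPlace_map`)

Stub of the birth line of the crux `ShadowsUniformize` (route `AbhyankarShadows`), dense-Abhyankar
branch (Knaf–Kuhlmann 2009, Thm. 1.5 with `P|_K = id`): the typed hypothesis "`O ∩ K₀` is an
Abhyankar place of `K₀|k`" lives inside the function field `K` (`Ω := K`, `V := O`), while the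
ambient machinery runs inside an algebraic closure `Ω' ⊇ K` with a valuation ring `V'`,
`V' ∩ K = O`. This file moves the Abhyankar property along such an embedding.

Setting: a homomorphism of fields `ι : Ω →+* Ω'`, valuation subrings `V ≤ Ω`, `V' ≤ Ω'` with
`ι⁻¹(V') = V` (`V'.comap ι = V`), subfields `K, F ≤ Ω`.

Claim: if `V` is an Abhyankar place of `F|K` (`IsAbhyankarPlace V K F`,
`ValuedFunctionFields.lean`: non-zero `x₁, …, x_ρ ∈ F` with values `ℤ`-independent modulo `vK`,
`y₁, …, y_τ ∈ V ∩ F` with residues algebraically independent over `KP`, and `F` algebraic over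
`K(x, y)`), then `V'` is an Abhyankar place of `ι(F)|ι(K)`.

Proof: this is exactly the transport lemma `isAbhyankarPlace_map` of the topic
`Literature/AlgebraicGeometry/Resolution` (`LocalUniformizationAbhyankarPlacesProofs.lean`,
section `Transport`), proved there with the witnesses `ι ∘ x`, `ι ∘ y`: values are compared
through `valuation_map_eq_iff` (the valuations `V'.valuation ∘ ι` and `V.valuation` are
equivalent), residues through the injective map of residue fields induced by the local
homomorphism `V → V'`, `a ↦ ι a` (Mathlib's `AlgebraicIndependent.ringHom_of_comp_eq`, the
induced map `KP → ι(K)P` being onto), and algebraicity over `K(x, y)` through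
`isAlgebraic_adjoin_map_iff`. We specialize it to the registered signature.
-/

noncomputable section

-- single-problem summit: the doubled namespace component is forced
set_option linter.dupNamespace false

open Literature.AlgebraicGeometry.Resolution IsLocalRing

namespace Summit.ResolutionOfSingularities.ResolutionOfSingularities.Theorems

/-- **Transport of the Abhyankar property along a field embedding.** If `ι : Ω → Ω'` is a
homomorphism of fields with `ι⁻¹(V') = V`, an Abhyankar place `(F|K, V)` maps to an Abhyankar
place `(ι F | ι K, V')`: the value-independent `xᵢ` and the residually independent `yⱼ` are moved
by `ι` (values along `valuation_map_eq_iff`, residues along the induced embedding of residue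
fields, algebraicity along `isAlgebraic_adjoin_map_iff`) — the tree's `isAbhyankarPlace_map`.
[folklore] -/
theorem stub_isAbhyankarPlace_map {Ω Ω' : Type} [Field Ω] [Field Ω'] (ι : Ω →+* Ω')
    {V : ValuationSubring Ω} {V' : ValuationSubring Ω'} (hV : V'.comap ι = V) {K F : Subfield Ω}
    (h : IsAbhyankarPlace V K F) : IsAbhyankarPlace V' (K.map ι) (F.map ι) :=
  isAbhyankarPlace_map ι hV h

end Summit.ResolutionOfSingularities.ResolutionOfSingularities.Theorems

end
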